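import Summits.ResolutionOfSingularities.ResolutionOfSingularities.Theorems.FrobeniusClosingSteerNonRationalWindowBiCone
import Summits.ResolutionOfSingularities.ResolutionOfSingularities.Theorems.FrobeniusClosingSteerNonRationalWindowHomogenize
import Summits.ResolutionOfSingularities.ResolutionOfSingularities.Theorems.FrobeniusClosingSteerNonRationalWindowLift
import HarnessLib

/-!
# Crux `Steer` (stmt-ResolutionOfSingularities-16345), β-leaf debt K-β0(a) — lemma (N) NEAR-A, part 2: the CONE DICHOTOMY at a landing point
  (res-D-pv-053 g9; res-L0-w41-plan-1 RULING 317 (c); reader res-L0-w41-tri-1 g8; memo `D/res-D-pv-053/K-BETA0A-SCOPE.md` §4)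

OURS (campaign `res-hironaka`, rung L ★L-G4, slot W4.1). Candidates' vocabulary made kernel; nothing here is a statement of H. Hironaka's manuscript
[Hironaka2017] (status: under review). AI-written; AI review is weaker than expert review. Def-free, Theses-free, 0 sorries; pure polynomial algebra.

## What is proved

Part 1 (`…ArithNearA`, `NearA.parityBound`) + res-D-repro-2's subring bridge (`NonRationalWindow.exists_initialForm_mem_pow`) put the dehomogenised
initial form `g = F̄(U := 1)` of the A-cone of the earlier stage into `𝔮^d`, `deg g ≤ d`, where `𝔮` is the maximal ideal of the landing point in
`κ_j[T₁, …, T_n]`. This file reads the cone off that membership: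

* `isHomogeneous_translate_of_mem_pow` — RATIONAL point `a` (`eval a` kills `𝔮`): `g ∈ 𝔮^d`, `deg g ≤ d` ⇒ `g(T + a)` is a FORM of degree `d`
  (translation carries `𝔮` into `(T)`, then Mathlib's `mem_pow_idealOfVars_iff`); i.e. `g` is a cone with vertex `a`.
* `eq_bind₁_linear_of_vertex` — homogenised reading: a form `Φ` of degree `d` whose dehomogenisation at `i` is a cone with vertex `a` IS
  `Ξ(X_j − a_j·X_i : j ≠ i)` with `Ξ = Φ(X_i := 1)(T + a)` — `Φ` lies in the subalgebra of the linear forms vanishing at the point `[1 : a]`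
  (so that point lies on the directrix of `Φ`; for the run: the landing point lies on `ℙ(Dir)` of the A-cone — the «near point» half of (N)).
* `cone_dichotomy` — over a PERFECT field and for a maximal `𝔮`: EITHER `𝔮` is rational with vertex `a` and `g(T + a)` is a form of degree `d`, OR
  `𝔮` is non-rational and `g = H(λ₁, …, λ_m)` is a form in `m < n` independent rational affine-linear forms vanishing at `𝔮` (the BI-CONE lemma
  `NonRationalWindow.biCone_holds`, p571774) — in four variables: a non-rational landing forces an A-cone in at most TWO variables.

[cite: CossartJannsenSaito2020, §2.2 (p. 24)] [folklore]
-/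

noncomputable section

-- `Summit.<S>.<S>.…` duplicates the summit name by design (single-problem summit).
set_option linter.dupNamespace false

open MvPolynomial
open Literature.AlgebraicGeometry.Resolution

namespace Summit.ResolutionOfSingularities.ResolutionOfSingularities.Theorems.SwitchingDichotomy.ArithTransport

namespace NearA

open NonRationalWindow NonRationalWindow.BiConeForms

/-! ## §1 A rational point: `g ∈ 𝔮^d` with `deg g ≤ d` is a cone with vertex the point -/

section Rational

variable {k : Type*} [Field k] {σ : Type*}

/-- **Cone with a rational vertex.** If `eval a` kills the ideal `𝔮` of `k[T_σ]` and `g ∈ 𝔮^d` has total degree `≤ d`, then the translate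
`g(T + a)` is a form of degree `d`. [cite: CossartJannsenSaito2020, §2.2 (p. 24)] -/
theorem isHomogeneous_translate_of_mem_pow (𝔮 : Ideal (MvPolynomial σ k)) (a : σ → k) (hrat : ∀ f ∈ 𝔮, eval a f = 0)
    {g : MvPolynomial σ k} {d : ℕ} (hdeg : g.totalDegree ≤ d) (hg : g ∈ 𝔮 ^ d) :
    (bind₁ (fun i => X i + C (a i)) g).IsHomogeneous d := by
  classical
  apply isHomogeneous_of_mem_pow_idealOfVars
  · let χ : MvPolynomial σ k →+* MvPolynomial σ k :=
      (bind₁ (fun i => X i + C (a i)) : MvPolynomial σ k →ₐ[k] MvPolynomial σ k).toRingHom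
    have hχ : Ideal.map χ 𝔮 ≤ idealOfVars σ k := by
      rw [Ideal.map_le_iff_le_comap]
      intro f hf
      rw [Ideal.mem_comap]
      have h1 : idealOfVars σ k = idealOfVars σ k ^ 1 := (pow_one _).symm
      rw [h1, mem_pow_idealOfVars_iff']
      intro x hx
      have hx0 : x = 0 := by
        by_contra h
        have : 1 ≤ x.degree := Nat.one_le_iff_ne_zero.mpr ((Finsupp.degree_eq_zero_iff x).not.mpr h)
        omega
      subst hx0
      change coeff 0 (bind₁ (fun i => X i + C (a i)) f) = 0
      rw [← constantCoeff_eq, ← eval_zero, eval_bind₁_translate, zero_add, hrat f hf]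
    have h := Ideal.mem_map_of_mem χ hg
    rw [Ideal.map_pow] at h
    exact Ideal.pow_right_mono hχ d h
  · exact (totalDegree_bind₁_translate_le _ _).trans hdeg

/-- Translating back: `g = (g(T + a))(T − a)`. [folklore] -/
theorem bind₁_translate_neg_translate (a : σ → k) (g : MvPolynomial σ k) :
    bind₁ (fun i => X i - C (a i)) (bind₁ (fun i => X i + C (a i)) g) = g := by
  rw [bind₁_bind₁]
  have : (fun i => bind₁ (fun i => X i - C (a i)) (X i + C (a i))) = (X : σ → MvPolynomial σ k) := by
    funext i
    rw [map_add, bind₁_X_right, bind₁_C_right, sub_add_cancel]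
  rw [this, bind₁_X_left, AlgHom.id_apply]

end Rational

/-! ## §2 Homogenised reading: the form lies in the subalgebra of the linear forms vanishing at the vertex -/

section Homogenize

variable {k : Type*} [Field k] {σ : Type*} [DecidableEq σ] (i : σ)

/-- Dehomogenising the linear form `X_j − a·X_i` (`j ≠ i`) gives `T_j − a`. [folklore] -/
theorem dehomogenize_X_sub_C_mul_X (j : {j : σ // j ≠ i}) (c : k) :
    dehomogenize i (X j.1 - C c * X i : MvPolynomial σ k) = X j - C c := by
  rw [map_sub, map_mul]
  change aeval (killVar i) (X j.1) - aeval (killVar i) (C c) * aeval (killVar i) (X i) = _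
  rw [aeval_X, aeval_X, aeval_C, killVar_of_ne i j.2, killVar_self, mul_one]
  rfl

/-- **Homogenised reading of a rational vertex.** A form `Φ` of degree `d` in the variables `σ` whose dehomogenisation at `i` translated by
`a` is again a form of degree `d` equals `Ξ(X_j − a_j X_i : j ≠ i)` with `Ξ := Φ(X_i := 1)(T + a)`: it lies in the subalgebra generated by
the linear forms vanishing at the point `(X_i, X_j) = (1, a_j)`. [cite: CossartJannsenSaito2020, §2.2 (p. 24)] -/
theorem eq_bind₁_linear_of_vertex {Φ : MvPolynomial σ k} {d : ℕ} (hΦ : Φ.IsHomogeneous d) (a : {j : σ // j ≠ i} → k)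
    (hΞ : (bind₁ (fun j => X j + C (a j)) (dehomogenize i Φ)).IsHomogeneous d) :
    Φ = bind₁ (fun j : {j : σ // j ≠ i} => X j.1 - C (a j) * X i) (bind₁ (fun j => X j + C (a j)) (dehomogenize i Φ)) := by
  refine eq_of_dehomogenize_eq i hΦ (isHomogeneous_bind₁_of_linear hΞ fun j => ?_) ?_
  · simpa using (isHomogeneous_X k j.1).sub ((isHomogeneous_C σ (a j)).mul (isHomogeneous_X k i))
  · -- dehomogenise the right-hand side: `X_j − a_j X_i ↦ T_j − a_j`, then translate back
    have hcomp : dehomogenize i (bind₁ (fun j : {j : σ // j ≠ i} => X j.1 - C (a j) * X i)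
        (bind₁ (fun j => X j + C (a j)) (dehomogenize i Φ))) =
        bind₁ (fun j : {j : σ // j ≠ i} => dehomogenize i (X j.1 - C (a j) * X i : MvPolynomial σ k))
          (bind₁ (fun j => X j + C (a j)) (dehomogenize i Φ)) := by
      change aeval (killVar i) (bind₁ _ _) = _
      rw [aeval_eq_bind₁, bind₁_bind₁]
      rfl
    rw [hcomp]
    simp_rw [dehomogenize_X_sub_C_mul_X]
    rw [bind₁_translate_neg_translate]

end Homogenize

/-! ## §3 The dichotomy at a maximal ideal over a perfect field -/

section Dichotomy

/-- **Cone dichotomy at a closed point.** `k` perfect, `𝔮` a maximal ideal of `k[T₁, …, T_n]`, `g ∈ 𝔮^d` of total degree `≤ d`. EITHER the point is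
RATIONAL, with vertex `a` (`eval a` kills `𝔮`) and `g(T + a)` a form of degree `d`; OR it is NON-RATIONAL and `g` is a form of degree `d` in
`m < n` independent rational affine-linear forms vanishing at `𝔮` (the bi-cone lemma `NonRationalWindow.biCone_holds`). [folklore] -/
theorem cone_dichotomy (k : Type) [Field k] [PerfectField k] (n : ℕ) (𝔮 : Ideal (MvPolynomial (Fin n) k)) [𝔮.IsMaximal]
    (g : MvPolynomial (Fin n) k) (d : ℕ) (hdeg : g.totalDegree ≤ d) (hg : g ∈ 𝔮 ^ d) :
    (∃ a : Fin n → k, (∀ f ∈ 𝔮, eval a f = 0) ∧ (bind₁ (fun i => X i + C (a i)) g).IsHomogeneous d) ∨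
    (∃ (m : ℕ) (lam : Fin m → MvPolynomial (Fin n) k) (H : MvPolynomial (Fin m) k),
      m < n ∧ (∀ i, (lam i).totalDegree ≤ 1 ∧ lam i ∈ 𝔮) ∧
      LinearIndependent k (fun i => lam i - MvPolynomial.C ((lam i).coeff 0)) ∧
      H.IsHomogeneous d ∧ g = MvPolynomial.aeval lam H) := by
  classical
  by_cases hs : Function.Surjective (algebraMap k (MvPolynomial (Fin n) k ⧸ 𝔮))
  · left
    -- the point is rational: `k ≅ k[T]/𝔮`, and `eval a` with `a_i ↦ [T_i]` kills `𝔮`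
    have hinj : Function.Injective (algebraMap k (MvPolynomial (Fin n) k ⧸ 𝔮)) :=
      (algebraMap k (MvPolynomial (Fin n) k ⧸ 𝔮)).injective
    let e : k ≃+* (MvPolynomial (Fin n) k ⧸ 𝔮) := RingEquiv.ofBijective _ ⟨hinj, hs⟩
    let a : Fin n → k := fun i => e.symm (Ideal.Quotient.mk 𝔮 (X i))
    have hφ : (e.symm.toRingHom.comp (Ideal.Quotient.mk 𝔮)) = (eval a : MvPolynomial (Fin n) k →+* k) := by
      refine MvPolynomial.ringHom_ext (fun c => ?_) (fun i => ?_)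
      · rw [RingHom.comp_apply, eval_C]
        change e.symm (Ideal.Quotient.mk 𝔮 (C c)) = c
        rw [RingEquiv.symm_apply_eq]
        change _ = algebraMap k (MvPolynomial (Fin n) k ⧸ 𝔮) c
        rw [IsScalarTower.algebraMap_apply k (MvPolynomial (Fin n) k) (MvPolynomial (Fin n) k ⧸ 𝔮), Ideal.Quotient.algebraMap_eq,
          MvPolynomial.algebraMap_eq]
      · rw [RingHom.comp_apply, eval_X]
        rfl
    refine ⟨a, fun f hf => ?_, ?_⟩
    · rw [← hφ, RingHom.comp_apply, Ideal.Quotient.eq_zero_iff_mem.mpr hf, map_zero]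
    · exact isHomogeneous_translate_of_mem_pow 𝔮 a (fun f hf => by
        rw [← hφ, RingHom.comp_apply, Ideal.Quotient.eq_zero_iff_mem.mpr hf, map_zero]) hdeg hg
  · right
    exact biCone_holds k n 𝔮 hs g d hdeg hg

end Dichotomy

/-! ## §4 Bookkeeping for the rational branch: the point ideal IS the kernel of evaluation -/

section RationalPoint

variable {k : Type*} [Field k] {σ : Type*}

/-- If `eval a` kills a MAXIMAL ideal `𝔮` of `k[T_σ]`, then `𝔮` is exactly the kernel of `eval a`. [folklore] -/
theorem mem_iff_eval_eq_zero_of_isMaximal (𝔮 : Ideal (MvPolynomial σ k)) [h𝔮 : 𝔮.IsMaximal] (a : σ → k)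
    (hrat : ∀ f ∈ 𝔮, eval a f = 0) (f : MvPolynomial σ k) : f ∈ 𝔮 ↔ eval a f = 0 := by
  refine ⟨hrat f, fun hf => ?_⟩
  have hle : 𝔮 ≤ RingHom.ker (eval a : MvPolynomial σ k →+* k) := fun g hg => (RingHom.mem_ker).mpr (hrat g hg)
  have hne : RingHom.ker (eval a : MvPolynomial σ k →+* k) ≠ ⊤ := by
    rw [Ne, Ideal.eq_top_iff_one, RingHom.mem_ker, map_one]
    exact one_ne_zero
  rw [h𝔮.eq_of_le hne hle, RingHom.mem_ker]
  exact hf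

/-- At a rational point `a` of a maximal `𝔮`: `X_i − a_i ∈ 𝔮`, and `X_i ∈ 𝔮 ↔ a_i = 0` (for the run: the landing point lies on the strict transform
`{T_i = 0}` of a hyperplane through the old centre iff its `i`-th coordinate vanishes — e.g. the SATELLITE test `u/u′ ∈ 𝔪′ ↔ a_U = 0`). [folklore] -/
theorem X_mem_iff_of_isMaximal (𝔮 : Ideal (MvPolynomial σ k)) [𝔮.IsMaximal] (a : σ → k) (hrat : ∀ f ∈ 𝔮, eval a f = 0) (i : σ) :
    (X i - C (a i) ∈ 𝔮) ∧ ((X i : MvPolynomial σ k) ∈ 𝔮 ↔ a i = 0) := by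
  refine ⟨(mem_iff_eval_eq_zero_of_isMaximal 𝔮 a hrat _).mpr (by rw [map_sub, eval_X, eval_C, sub_self]), ?_⟩
  rw [mem_iff_eval_eq_zero_of_isMaximal 𝔮 a hrat, eval_X]

end RationalPoint

end NearA

end Summit.ResolutionOfSingularities.ResolutionOfSingularities.Theorems.SwitchingDichotomy.ArithTransport

end
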